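import Summits.BirchSwinnertonDyer.BirchSwinnertonDyer.Theorems.AdditiveKolyvaginRoadLevelSystemsTransfer
import Summits.BirchSwinnertonDyer.BirchSwinnertonDyer.Theorems.AdditiveKolyvaginRoadKolyvaginToricConj
import Literature.NumberTheory.EllipticCurves.CongruenceVisibility
import Literature.NumberTheory.EllipticCurves.HeegnerPointsKolyvaginLocalCriterion
import HarnessLib

/-!
# Route `AdditiveKolyvaginRoad`, crux `LevelKolyvaginSystemsAdditive` (item stmt-BirchSwinnertonDyer-21396, KS′):
# CONGRUENCE BOOKKEEPING for the transfer socket — the local kernels, the transverse ∕ toric conditions, the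
# Kolyvagin and the admissible primes all transport along a Galois-equivariant isomorphism `E₀[p] ≅ E[p]`
# (cell `pub/bsd-wall`, width seat `bsd-wall-akr-p2x-w3` g2; `--supports stmt-BirchSwinnertonDyer-21396`, helper;
# item (T-A1ℓ) «provable now» of `Cruxes/LevelKolyvaginSystemsAdditive/SOCKETS-TRANSFER.md`)

WHY THIS FILE. The landed transfer socket `nonempty_levelKolyvaginSystemP_of_congr`
(`AdditiveKolyvaginRoadLevelSystemsTransfer`, p582516) moves a level Kolyvagin system of a LENDER `E₀ = W₀` to the
frame's curve `E = W` along an ABSTRACT additive isomorphism `θ : H¹(K, E₀[p]) ≃ H¹(K, E[p])`, taking as explicit binders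
seven compatibilities of `θ` — (θc) with complex conjugation, (θ0) with local triviality, (θK) with the Kummer
conditions, (θT) with the toric conditions, (θTr) with the transverse conditions, and the coincidence of the (Kol)
Kolyvagin and (Adm) admissible primes of the two curves. For the `θ` the crux ideas mean — the map `θ_* = h1Equiv θ`
induced on `H¹` by a `Γ_K`-equivariant isomorphism of the `p`-torsion POINTS `θ : E₀[p](K̄) ≃ E[p](K̄)` (a mod-`p`
congruence, Cremona–Mazur) — all of these except (θK) at the finitely many places above `p N N₀` are FORMAL, and this
file proves them in the tree's Galois-cohomology currency:

* §1 (Adm) `isAdmissiblePrime_iff_of_congr` — Bertolini–Darmon admissibility at exponent `1` only reads `q ∤ pN` and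
  `a_q mod p`: it coincides for two levels with the same prime support and Hecke eigenvalues congruent mod `p` off it.
* §2 (Kol) `isKolyvaginPrime_iff_of_congr` — W. Zhang's Kolyvagin primes (`ℓ ∤ NDp` inert with `M(ℓ) > 0`, i.e.
  `p ∣ ℓ + 1`, `p ∣ a_ℓ`) likewise read `E` only through `ℓ ∤ N` and `a_ℓ mod p`.
* §3 (θTr) `torsionFixing_eq_of_congr`, `h1Eval_h1Equiv`, `h1Equiv_mem_transverseLocalKerP_iff` — `Γ_{K(E[p])} =
  Γ_{K(E₀[p])}`, the pairing `[θ_* x, ρ] = θ [x, ρ]`, hence W. Zhang's transverse condition corresponds under `θ_*`.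
* §4 (θ0) `h1Equiv_mem_torsionLocalKer_iff` — local triviality `x_v = 0 ∈ H¹(K_v, E[p])` corresponds (the local
  torsion `E[p](K̄_v)` is identified with `E[p](K̄)` on both sides, `torsionPointsMap_bijective`).
* §5 (θT) `h1Equiv_mem_toricLocalKer_iff` — the TORIC condition (cocycle valued in the augmentation line
  `⟨g•y − y⟩` of the local torsion) corresponds, the local transport being `Γ_{K_v}`-equivariant.
* §6 (θK, unramified part) `h1Equiv_mem_selmerLocalKer_iff_of_hasGoodReductionAt` — at a place of good reduction for
  BOTH curves not dividing `p`, the Kummer conditions are «unramified» (Gross (7.1), tree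
  `selmerLocalKer_eq_unramifiedKer`) and correspond (`mem_unramifiedKer_iff_h1Equiv_mem`).
The companion file `AdditiveKolyvaginRoadLevelSystemsCongruenceSocket` adds (θc) (`θ_*` commutes with `conjAct σ` when
`θ` commutes with a lift of `σ` on the torsion points) and the REPACKAGED SOCKET: `LevelKolyvaginSystemP W K p Dt β ι c`
is inhabited given the lender's system `S₀`, such a `θ`, `rad(pN) = rad(pN₀)`, `a_q(E) ≡ a_q(E₀) (mod p)` off `pN`,
good reduction of both curves off `pNN₀` — and ONLY two substantive binders: (θK) at the places above `p N N₀` (at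
`v ∣ p`: the ideas' load-bearing parity ∕ ε-matching input) and (A2) the bottom transfer of Kolyvagin non-vanishing.

HONEST FRAMING: theorems only; 0 definitions, 0 named facts, 0 `sorry`; E-side bookkeeping — the open content of the
crux ((A2), (θK) above `p`, the lender's system at `p² ∣ N`) is untouched; closes nothing. BSD is not proved by any of
this.

References: [cite: WZhang2014, Notations (xiv), §8.1, Thm. 4.3] [cite: BertoliniDarmon2005, p. 18, §2.2–§2.3]
[cite: GrossLMS1991, §3 (3.1)–(3.2), §7 (7.1), §9] [cite: CremonaMazur2000, §3] [cite: SerreGaloisCohomology1997, I §2.4].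
-/

-- single-conjunct summit: `Summit.BirchSwinnertonDyer.BirchSwinnertonDyer.…` repeats the name by design
set_option linter.dupNamespace false

noncomputable section

open scoped Classical

namespace Summit.BirchSwinnertonDyer.BirchSwinnertonDyer.Theorems.AdditiveKoly

open WeierstrassCurve NumberField IsDedekindDomain Field
  Literature.NumberTheory.EllipticCurves Literature.NumberTheory.EllipticCurves.ModularForms
  Literature.NumberTheory.GaloisRepresentations Module
  Summit.BirchSwinnertonDyer.Rank1Residual.X11b.Three.Koly.ZhangSupply.LocalConj

/-! ## §1 (Adm) Bertolini–Darmon admissibility transports along a congruence of Hecke eigenvalues -/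

section Adm

variable (K : Type) [Field K]

/-- **(Adm)** Bertolini–Darmon `1`-admissibility (`q` prime, `q ∤ pN`, `(q)` prime in `𝓞 K`, `p ∤ q² − 1`,
`p ∣ q + 1 ∓ a_q`) coincides for two levels `N, N₀` with the same prime support of `pN`, `pN₀` and eigenvalue systems
`a, a₀` congruent mod `p` at the primes off `pN`. [cite: BertoliniDarmon2005, p. 18 (Admissible primes)] -/
theorem isAdmissiblePrime_iff_of_congr {N N₀ p : ℕ} {a a₀ : ℕ → ℤ}
    (hrad : ∀ q : ℕ, q.Prime → (q ∣ p * N ↔ q ∣ p * N₀))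
    (ha : ∀ q : ℕ, q.Prime → ¬ q ∣ p * N → (p : ℤ) ∣ a q - a₀ q) (q : ℕ) :
    BertoliniDarmon2005.IsAdmissiblePrime N K a p 1 q ↔ BertoliniDarmon2005.IsAdmissiblePrime N₀ K a₀ p 1 q := by
  rw [BertoliniDarmon2005.isAdmissiblePrime_iff, BertoliniDarmon2005.isAdmissiblePrime_iff, pow_one]
  constructor
  · rintro ⟨hq, hN, hI, h2, h4⟩
    have hc := ha q hq hN
    refine ⟨hq, fun h ↦ hN ((hrad q hq).mpr h), hI, h2, ?_⟩
    rcases h4 with h4 | h4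
    · left
      have : (q : ℤ) + 1 - a₀ q = ((q : ℤ) + 1 - a q) + (a q - a₀ q) := by ring
      rw [this]; exact dvd_add h4 hc
    · right
      have : (q : ℤ) + 1 + a₀ q = ((q : ℤ) + 1 + a q) - (a q - a₀ q) := by ring
      rw [this]; exact dvd_sub h4 hc
  · rintro ⟨hq, hN₀, hI, h2, h4⟩
    have hN : ¬ q ∣ p * N := fun h ↦ hN₀ ((hrad q hq).mp h)
    have hc := ha q hq hN
    refine ⟨hq, hN, hI, h2, ?_⟩
    rcases h4 with h4 | h4
    · left
      have : (q : ℤ) + 1 - a q = ((q : ℤ) + 1 - a₀ q) - (a q - a₀ q) := by ring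
      rw [this]; exact dvd_sub h4 hc
    · right
      have : (q : ℤ) + 1 + a q = ((q : ℤ) + 1 + a₀ q) + (a q - a₀ q) := by ring
      rw [this]; exact dvd_add h4 hc

end Adm

/-! ## §2 (Kol) W. Zhang's Kolyvagin primes transport along a congruence of Hecke eigenvalues -/

section Kol

variable (W W₀ : WeierstrassCurve ℚ) [W.IsGloballyMinimal] [W₀.IsGloballyMinimal] (K : Type) [Field K]
  [NumberField K] (p : ℕ) [Fact p.Prime]

/-- For primes `ℓ ≠ p`: `ℓ ∣ pN ↔ ℓ ∣ N`. [folklore] -/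
theorem prime_dvd_mul_iff_of_ne {ℓ p N : ℕ} (hℓ : ℓ.Prime) (hp : p.Prime) (hne : ℓ ≠ p) :
    ℓ ∣ p * N ↔ ℓ ∣ N := by
  rw [hℓ.dvd_mul]
  refine ⟨fun h ↦ h.elim (fun h ↦ absurd ((Nat.prime_dvd_prime_iff_eq hℓ hp).mp h) hne) id, Or.inr⟩

/-- **(Kol)** W. Zhang's Kolyvagin primes (`ℓ` prime, `ℓ ∤ N`, `ℓ ∤ d_K`, `ℓ ≠ p`, `(ℓ)` prime in `𝓞 K`,
`M(ℓ) = min{v_p(ℓ + 1), v_p(a_ℓ)} > 0`) of `(E, K, p)` at level `N` and of `(E₀, K, p)` at level `N₀` COINCIDE when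
`pN`, `pN₀` have the same prime support and `a_q(E) ≡ a_q(E₀) (mod p)` at the primes `q ∤ pN`: the definition reads
`E` only through `ℓ ∤ N` and `a_ℓ mod p`. [cite: WZhang2014, Notations (xii)] [cite: GrossLMS1991, §3 (3.3)] -/
theorem isKolyvaginPrime_iff_of_congr {N N₀ : ℕ}
    (hrad : ∀ q : ℕ, q.Prime → (q ∣ p * N ↔ q ∣ p * N₀))
    (ha : ∀ q : ℕ, q.Prime → ¬ q ∣ p * N → (p : ℤ) ∣ W.frobeniusTrace q - W₀.frobeniusTrace q) (ℓ : ℕ) :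
    Zhang2014.IsKolyvaginPrime N W K p ℓ ↔ Zhang2014.IsKolyvaginPrime N₀ W₀ K p ℓ := by
  have hp : p.Prime := Fact.out
  -- `0 < M(ℓ)` unfolded on both sides
  have hM : ∀ (V : WeierstrassCurve ℚ) [V.IsGloballyMinimal], 0 < Zhang2014.kolyvaginIndex V p ℓ ↔
      p ∣ ℓ + 1 ∧ (p : ℤ) ∣ V.frobeniusTrace ℓ := fun V _ ↦ by
    rw [Nat.lt_iff_add_one_le, zero_add, Zhang2014.le_kolyvaginIndex_iff, pow_one, pow_one]
  unfold Zhang2014.IsKolyvaginPrime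
  rw [hM W, hM W₀]
  constructor
  · rintro ⟨hℓ, hN, hd, hne, hI, h1, ha'⟩
    have hpN : ¬ ℓ ∣ p * N := fun h ↦ hN ((prime_dvd_mul_iff_of_ne hℓ hp hne).mp h)
    have hc := ha ℓ hℓ hpN
    refine ⟨hℓ, fun h ↦ hpN ?_, hd, hne, hI, h1, ?_⟩
    · exact (hrad ℓ hℓ).mpr ((prime_dvd_mul_iff_of_ne hℓ hp hne).mpr h)
    · have : W₀.frobeniusTrace ℓ = W.frobeniusTrace ℓ - (W.frobeniusTrace ℓ - W₀.frobeniusTrace ℓ) := by ring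
      rw [this]; exact dvd_sub ha' hc
  · rintro ⟨hℓ, hN₀, hd, hne, hI, h1, ha'⟩
    have hpN : ¬ ℓ ∣ p * N := fun h ↦
      hN₀ ((prime_dvd_mul_iff_of_ne hℓ hp hne).mp ((hrad ℓ hℓ).mp h))
    have hc := ha ℓ hℓ hpN
    refine ⟨hℓ, fun h ↦ hpN ((prime_dvd_mul_iff_of_ne hℓ hp hne).mpr h), hd, hne, hI, h1, ?_⟩
    have : W.frobeniusTrace ℓ = W₀.frobeniusTrace ℓ + (W.frobeniusTrace ℓ - W₀.frobeniusTrace ℓ) := by ring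
    rw [this]; exact dvd_add ha' hc

end Kol

/-! ## §3 (θTr) `Γ_{K(E[p])}`, the pairing `[x, ρ]` and the transverse condition transport -/

section Transverse

variable {K : Type} [Field K] (V V₀ : WeierstrassCurve K) {n : ℤ}
  (θ : geomTorsion V₀ n ≃+ geomTorsion V n)
  (hθ : ∀ (g : absoluteGaloisGroup K) (P : geomTorsion V₀ n), θ (g • P) = g • θ P)
include hθ

/-- `Γ_{K(E[n])} = Γ_{K(E₀[n])}`: an element of `Γ_K` fixes `E[n]` pointwise iff it fixes `E₀[n]` pointwise, the two
being isomorphic `Γ_K`-modules. [folklore] -/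
theorem torsionFixing_eq_of_congr : torsionFixing V n = torsionFixing V₀ n := by
  ext ρ
  rw [mem_torsionFixing_iff, mem_torsionFixing_iff]
  refine ⟨fun h P ↦ θ.injective (by rw [hθ, h]), fun h P ↦ ?_⟩
  obtain ⟨P₀, rfl⟩ := θ.surjective P
  rw [← hθ, h]

/-- **The pairing transports: `[θ_* x, ρ] = θ [x, ρ]`** for `ρ ∈ Γ_{K(E₀[n])}` (a cocycle of `θ_* x` is `θ ∘` a
cocycle of `x`, and the pairing is computed by any cocycle on `Γ_{K(E[n])}`). [cite: GrossLMS1991, §9 (pairing)] -/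
theorem h1Eval_h1Equiv (x : galH1Torsion V₀ n) {ρ : absoluteGaloisGroup K} (hρ : ρ ∈ torsionFixing V₀ n) :
    h1Eval V n (h1Equiv θ hθ x) ρ = θ (h1Eval V₀ n x ρ) := by
  have hρ' : ρ ∈ torsionFixing V n := by rwa [torsionFixing_eq_of_congr V V₀ θ hθ]
  conv_lhs => rw [← oneCocycleClass_reprCocycle V₀ n x, h1Equiv_oneCocycleClass V V₀ θ hθ,
    h1Eval_oneCocycleClass V n _ hρ', h1Equiv_oneCocycleClass_apply]
  rfl

end Transverse

section TransverseP

variable (W W₀ : WeierstrassCurve ℚ) (K : Type) [Field K] [NumberField K] (p : ℕ)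
  (θ : geomTorsion (W₀.baseChange K) ((p ^ 1 : ℕ) : ℤ) ≃+ geomTorsion (W.baseChange K) ((p ^ 1 : ℕ) : ℤ))
  (hθ : ∀ (g : absoluteGaloisGroup K) (P : geomTorsion (W₀.baseChange K) ((p ^ 1 : ℕ) : ℤ)), θ (g • P) = g • θ P)
include hθ

/-- **(θTr) W. Zhang's TRANSVERSE condition transports**: `θ_* x ∈ H¹_tr(K_λ)`-kernel of `E` iff `x ∈` that of
`E₀` — the condition asks the pairing `[·, d]` to vanish on a subgroup of `Γ_{K(E[p])} = Γ_{K(E₀[p])}` described by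
`K`, `ι`, `ℓ` alone, and `[θ_* x, d] = θ [x, d]`. [cite: WZhang2014, §8.1 (H¹_tr)] [cite: GrossLMS1991, §9] -/
theorem h1Equiv_mem_transverseLocalKerP_iff (ι : K →+* ℂ) (ℓ : ℕ) (v : HeightOneSpectrum (𝓞 K))
    (x : Vp W₀ K p) :
    h1Equiv θ hθ x ∈ transverseLocalKerP W K p ι ℓ v ↔ x ∈ transverseLocalKerP W₀ K p ι ℓ v := by
  rw [mem_transverseLocalKerP_iff, mem_transverseLocalKerP_iff]
  refine ⟨fun h 𝔓 h𝔓 d hdD hdS hdT ↦ ?_, fun h 𝔓 h𝔓 d hdD hdS hdT ↦ ?_⟩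
  · have hdT' : d ∈ torsionFixing (W.baseChange K) ((p ^ 1 : ℕ) : ℤ) := by
      rwa [torsionFixing_eq_of_congr _ _ θ hθ]
    have h1 := h 𝔓 h𝔓 d hdD hdS hdT'
    rw [h1Eval_h1Equiv _ _ θ hθ x hdT, map_eq_zero_iff _ θ.injective] at h1
    exact h1
  · have hdT' : d ∈ torsionFixing (W₀.baseChange K) ((p ^ 1 : ℕ) : ℤ) := by
      rwa [← torsionFixing_eq_of_congr _ _ θ hθ]
    rw [h1Eval_h1Equiv _ _ θ hθ x hdT', map_eq_zero_iff _ θ.injective]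
    exact h 𝔓 h𝔓 d hdD hdS hdT'

end TransverseP

/-! ## §4 (θ0) Local triviality `x_v = 0` transports

For a `K`-field `E` (a completion `K_v`) the local torsion `E[n](K̄_E)` is `E[n](K̄)` moved along the chosen embedding
(`torsionPointsMap`, a bijection for an elliptic curve in characteristic `0`: `torsionPointsMap_bijective`), so a
`Γ_K`-isomorphism `θ : E₀[n](K̄) ≃ E[n](K̄)` induces a `Γ_E`-isomorphism `θ_E : E₀[n](K̄_E) ≃ E[n](K̄_E)` over it, and
the kernels of `H¹(K, E₀[n]) → H¹(E, E₀[n])`, `H¹(K, E[n]) → H¹(E, E[n])` correspond (`mem_resKer_iff_h1Equiv_mem`). -/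

section Local

variable {K : Type} [Field K] [NumberField K] (V V₀ : WeierstrassCurve K) [V.IsElliptic] [V₀.IsElliptic]
  (E : Type) [Field E] [Algebra K E] [CharZero E] {n : ℕ} (hn : n ≠ 0)
  (θ : geomTorsion V₀ (n : ℤ) ≃+ geomTorsion V (n : ℤ))
  (hθ : ∀ (g : absoluteGaloisGroup K) (P : geomTorsion V₀ (n : ℤ)), θ (g • P) = g • θ P)
include hn hθ

/-- **The local transport.** A `Γ_K`-isomorphism `θ : E₀[n](K̄) ≃ E[n](K̄)` induces a `Γ_E`-isomorphism
`θ_E : E₀[n](K̄_E) ≃ E[n](K̄_E)` of the local torsion INTERTWINING the two localisation maps of points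
(`torsionPointsMap ∘ θ = θ_E ∘ torsionPointsMap`): `θ_E := loc ∘ θ ∘ loc₀⁻¹`, both `loc`'s being bijective.
[cite: SerreGaloisCohomology1997, I §2.4] -/
theorem exists_localTorsionEquiv_of_congr :
    ∃ θE : AddSubgroup.torsionBy (localPoints V₀ E) (n : ℤ) ≃+ AddSubgroup.torsionBy (localPoints V E) (n : ℤ),
      (∀ (g : absoluteGaloisGroup E) (Q : AddSubgroup.torsionBy (localPoints V₀ E) (n : ℤ)), θE (g • Q) = g • θE Q) ∧
      ∀ P : geomTorsion V₀ (n : ℤ), torsionPointsMap V E (n : ℤ) (θ P) = θE (torsionPointsMap V₀ E (n : ℤ) P) := by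
  let e₀ : geomTorsion V₀ (n : ℤ) ≃+ AddSubgroup.torsionBy (localPoints V₀ E) (n : ℤ) :=
    AddEquiv.ofBijective (torsionPointsMap V₀ E (n : ℤ)) (torsionPointsMap_bijective V₀ E hn)
  let e : geomTorsion V (n : ℤ) ≃+ AddSubgroup.torsionBy (localPoints V E) (n : ℤ) :=
    AddEquiv.ofBijective (torsionPointsMap V E (n : ℤ)) (torsionPointsMap_bijective V E hn)
  have he₀ : ∀ P, e₀ P = torsionPointsMap V₀ E (n : ℤ) P := fun _ ↦ rfl
  have he : ∀ P, e P = torsionPointsMap V E (n : ℤ) P := fun _ ↦ rfl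
  refine ⟨e₀.symm.trans (θ.trans e), fun g Q ↦ ?_, fun P ↦ ?_⟩
  · obtain ⟨P₀, rfl⟩ := e₀.surjective Q
    rw [AddEquiv.trans_apply, AddEquiv.trans_apply, AddEquiv.trans_apply, AddEquiv.trans_apply,
      AddEquiv.symm_apply_apply, he₀, ← torsionPointsMap_smul, ← he₀, AddEquiv.symm_apply_apply, hθ, he, he,
      torsionPointsMap_smul]
  · rw [AddEquiv.trans_apply, AddEquiv.trans_apply, ← he₀, AddEquiv.symm_apply_apply, he]

/-- **(θ0) Local triviality transports**: `θ_* x` dies in `H¹(E, E[n])` iff `x` dies in `H¹(E, E₀[n])` (tree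
`torsionLocalKer` = W. Zhang's «localisation zero», the base-locus condition of Def. 8.3). [cite: WZhang2014, Def. 8.3]
[cite: SerreGaloisCohomology1997, I §2.4] -/
theorem h1Equiv_mem_torsionLocalKer_iff (x : galH1Torsion V₀ (n : ℤ)) :
    h1Equiv θ hθ x ∈ V.torsionLocalKer E (n : ℤ) ↔ x ∈ V₀.torsionLocalKer E (n : ℤ) := by
  obtain ⟨θE, hθE, hsq⟩ := exists_localTorsionEquiv_of_congr V V₀ E hn θ hθ
  exact (mem_resKer_iff_h1Equiv_mem (resGal (K := K) E) (torsionPointsMap V₀ E (n : ℤ))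
    (torsionPointsMap_smul V₀ E (n : ℤ)) (torsionPointsMap V E (n : ℤ)) (torsionPointsMap_smul V E (n : ℤ))
    θ hθ θE hθE hsq x).symm

/-! ## §5 (θT) The TORIC condition transports -/

omit [NumberField K] [V.IsElliptic] [V₀.IsElliptic] [CharZero E] hn in
/-- The localisation maps intertwine `θ_*` and `(θ_E)_*`: `loc_E (θ_* x) = (θ_E)_* (loc_E x)` in `H¹(E, E[n](K̄_E))`
(both sides are the map of the compatible pair `(resGal E, loc ∘ θ = θ_E ∘ loc₀)`). [cite: SerreGaloisCohomology1997, I §2.4] -/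
theorem torsionLocMap_h1Equiv
    (θE : AddSubgroup.torsionBy (localPoints V₀ E) (n : ℤ) ≃+ AddSubgroup.torsionBy (localPoints V E) (n : ℤ))
    (hθE : ∀ (g : absoluteGaloisGroup E) (Q : AddSubgroup.torsionBy (localPoints V₀ E) (n : ℤ)), θE (g • Q) = g • θE Q)
    (hsq : ∀ P : geomTorsion V₀ (n : ℤ), torsionPointsMap V E (n : ℤ) (θ P) = θE (torsionPointsMap V₀ E (n : ℤ) P))
    (x : galH1Torsion V₀ (n : ℤ)) :
    V.torsionLocMap E (n : ℤ) (h1Equiv θ hθ x) = h1Equiv θE hθE (V₀.torsionLocMap E (n : ℤ) x) := by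
  change resH1Hom (resGal (K := K) E) (torsionPointsMap V E (n : ℤ)) (torsionPointsMap_smul V E (n : ℤ))
      (resH1Hom (ContinuousMonoidHom.id _) (θ : geomTorsion V₀ (n : ℤ) →+ geomTorsion V (n : ℤ)) hθ x) =
    resH1Hom (ContinuousMonoidHom.id _)
      (θE : AddSubgroup.torsionBy (localPoints V₀ E) (n : ℤ) →+ AddSubgroup.torsionBy (localPoints V E) (n : ℤ)) hθE
      (resH1Hom (resGal (K := K) E) (torsionPointsMap V₀ E (n : ℤ)) (torsionPointsMap_smul V₀ E (n : ℤ)) x)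
  rw [resH1Hom_resH1Hom, resH1Hom_resH1Hom]
  exact congrFun (congrArg DFunLike.coe (resH1Hom_congr (by ext; rfl) (AddMonoidHom.ext fun P ↦ hsq P) _ _)) x

omit [NumberField K] [V.IsElliptic] [V₀.IsElliptic] [CharZero E] hn hθ in
/-- A `Γ_E`-equivariant map of the local torsion sends the augmentation line `⟨g • y − y⟩` of `E₀[n](K̄_E)` into that
of `E[n](K̄_E)` (`θ_E (g • y − y) = g • θ_E y − θ_E y`). [folklore] -/
theorem map_mem_augmentationPoints_of_equivariant
    (θE : AddSubgroup.torsionBy (localPoints V₀ E) (n : ℤ) ≃+ AddSubgroup.torsionBy (localPoints V E) (n : ℤ))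
    (hθE : ∀ (g : absoluteGaloisGroup E) (Q : AddSubgroup.torsionBy (localPoints V₀ E) (n : ℤ)), θE (g • Q) = g • θE Q)
    (m : AddSubgroup.torsionBy (localPoints V₀ E) (n : ℤ))
    (hm : m ∈ augmentationPoints (absoluteGaloisGroup E) (AddSubgroup.torsionBy (localPoints V₀ E) (n : ℤ))) :
    θE m ∈ augmentationPoints (absoluteGaloisGroup E) (AddSubgroup.torsionBy (localPoints V E) (n : ℤ)) := by
  unfold augmentationPoints at hm ⊢
  have h := (AddSubgroup.closure_le ((AddSubgroup.closure
      {m : AddSubgroup.torsionBy (localPoints V E) (n : ℤ) | ∃ (g : absoluteGaloisGroup E)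
        (x : AddSubgroup.torsionBy (localPoints V E) (n : ℤ)), m = g • x - x}).comap
      (θE : AddSubgroup.torsionBy (localPoints V₀ E) (n : ℤ) →+ AddSubgroup.torsionBy (localPoints V E) (n : ℤ)))).mpr
    (fun m' hm' ↦ ?_) hm
  · rw [AddSubgroup.mem_comap] at h
    exact h
  obtain ⟨g, y, rfl⟩ := hm'
  rw [SetLike.mem_coe, AddSubgroup.mem_comap, AddMonoidHom.coe_coe, map_sub, hθE]
  exact AddSubgroup.subset_closure ⟨g, θE y, rfl⟩

/-- One direction of (θT): `x ∈ toricLocalKer E₀ ⟹ θ_* x ∈ toricLocalKer E`. [cite: BertoliniDarmon2005, §2.2–§2.3]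
[cite: WZhang2014, §4.1 (H¹_ord)] -/
theorem h1Equiv_mem_toricLocalKer_of_mem {x : galH1Torsion V₀ (n : ℤ)} (hx : x ∈ toricLocalKer V₀ E (n : ℤ)) :
    h1Equiv θ hθ x ∈ toricLocalKer V E (n : ℤ) := by
  obtain ⟨θE, hθE, hsq⟩ := exists_localTorsionEquiv_of_congr V V₀ E hn θ hθ
  change V.torsionLocMap E (n : ℤ) (h1Equiv θ hθ x) ∈ valuedClasses (G := absoluteGaloisGroup E)
    (augmentationPoints (absoluteGaloisGroup E) (AddSubgroup.torsionBy (localPoints V E) (n : ℤ)))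
  change V₀.torsionLocMap E (n : ℤ) x ∈ valuedClasses (G := absoluteGaloisGroup E)
    (augmentationPoints (absoluteGaloisGroup E) (AddSubgroup.torsionBy (localPoints V₀ E) (n : ℤ))) at hx
  rw [torsionLocMap_h1Equiv V V₀ E θ hθ θE hθE hsq]
  have hθE' : ∀ (g : absoluteGaloisGroup E) (Q : AddSubgroup.torsionBy (localPoints V₀ E) (n : ℤ)),
      (θE : AddSubgroup.torsionBy (localPoints V₀ E) (n : ℤ) →+ AddSubgroup.torsionBy (localPoints V E) (n : ℤ))
        (ContinuousMonoidHom.id (absoluteGaloisGroup E) g • Q) =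
      g • (θE : AddSubgroup.torsionBy (localPoints V₀ E) (n : ℤ) →+ AddSubgroup.torsionBy (localPoints V E) (n : ℤ)) Q :=
    fun g Q ↦ hθE g Q
  have h2 := map_mem_valuedClasses (ContinuousMonoidHom.id (absoluteGaloisGroup E))
    (θE : AddSubgroup.torsionBy (localPoints V₀ E) (n : ℤ) →+ AddSubgroup.torsionBy (localPoints V E) (n : ℤ)) hθE'
    (fun m hm ↦ map_mem_augmentationPoints_of_equivariant V V₀ E θE hθE m hm) hx
  change (ContinuousCohomology.map (ContinuousMonoidHom.id (absoluteGaloisGroup E))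
      (resHomOfEquivariant (ContinuousMonoidHom.id (absoluteGaloisGroup E))
        (θE : AddSubgroup.torsionBy (localPoints V₀ E) (n : ℤ) →+ AddSubgroup.torsionBy (localPoints V E) (n : ℤ))
        hθE') 1).hom.toLinearMap.toAddMonoidHom (V₀.torsionLocMap E (n : ℤ) x) ∈ _
  simpa only [LinearMap.toAddMonoidHom_coe, ContinuousLinearMap.coe_coe] using h2

end Local

section LocalIff

variable {K : Type} [Field K] [NumberField K] (V V₀ : WeierstrassCurve K) [V.IsElliptic] [V₀.IsElliptic]
  (E : Type) [Field E] [Algebra K E] [CharZero E] {n : ℕ} (hn : n ≠ 0)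
  (θ : geomTorsion V₀ (n : ℤ) ≃+ geomTorsion V (n : ℤ))
  (hθ : ∀ (g : absoluteGaloisGroup K) (P : geomTorsion V₀ (n : ℤ)), θ (g • P) = g • θ P)
include hn hθ

/-- **(θT) The TORIC condition transports**: `θ_* x ∈ toricLocalKer E ↔ x ∈ toricLocalKer E₀` (the converse from
`θ⁻¹`, as `(θ_*)⁻¹ = (θ⁻¹)_*`). [cite: BertoliniDarmon2005, §2.2–§2.3 (H¹_ord)] [cite: WZhang2014, §4.1] -/
theorem h1Equiv_mem_toricLocalKer_iff (x : galH1Torsion V₀ (n : ℤ)) :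
    h1Equiv θ hθ x ∈ toricLocalKer V E (n : ℤ) ↔ x ∈ toricLocalKer V₀ E (n : ℤ) := by
  refine ⟨fun h ↦ ?_, h1Equiv_mem_toricLocalKer_of_mem V V₀ E hn θ hθ⟩
  have h' := h1Equiv_mem_toricLocalKer_of_mem V₀ V E hn θ.symm (symm_equivariant θ hθ) h
  have e : h1Equiv θ.symm (symm_equivariant θ hθ) (h1Equiv θ hθ x) = x := (h1Equiv θ hθ).symm_apply_apply x
  rwa [e] at h'

end LocalIff

/-! ## §6 (θK, unramified part) The Kummer conditions correspond at good places `v ∤ n` -/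

section Good

variable {K : Type} [Field K] [NumberField K] (V V₀ : WeierstrassCurve K) [V.IsElliptic] [V₀.IsElliptic] {n : ℤ}
  (θ : geomTorsion V₀ n ≃+ geomTorsion V n)
  (hθ : ∀ (g : absoluteGaloisGroup K) (P : geomTorsion V₀ n), θ (g • P) = g • θ P)
include hθ

/-- **(θK) at a good place `v ∤ n` of both curves**: the Kummer local conditions
`ker (H¹(K, E[n]) → H¹(K_v, E))` of `E` and `E₀` correspond under `θ_*` — both are «unramified at `v`» (Gross 1991
(7.1)/(7.4), tree `selmerLocalKer_eq_unramifiedKer`), a condition on the cocycle's restriction to inertia that `θ`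
respects (`mem_unramifiedKer_iff_h1Equiv_mem`). [cite: GrossLMS1991, §7 (7.1), (7.4)] [cite: CremonaMazur2000, §3] -/
theorem h1Equiv_mem_selmerLocalKer_iff_of_hasGoodReductionAt {v : HeightOneSpectrum (𝓞 K)}
    (hv : V.HasGoodReductionAt v) (hv₀ : V₀.HasGoodReductionAt v) (hvn : (n : 𝓞 K) ∉ v.asIdeal)
    (x : galH1Torsion V₀ n) :
    h1Equiv θ hθ x ∈ selmerLocalKer V (v.adicCompletion K) n ↔ x ∈ selmerLocalKer V₀ (v.adicCompletion K) n := by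
  obtain ⟨𝔓, h𝔓⟩ := v.primesAbove_nonempty
  rw [V.selmerLocalKer_eq_unramifiedKer hv hvn h𝔓, V₀.selmerLocalKer_eq_unramifiedKer hv₀ hvn h𝔓]
  exact (mem_unramifiedKer_iff_h1Equiv_mem V V₀ θ hθ 𝔓 x).symm

end Good

end Summit.BirchSwinnertonDyer.BirchSwinnertonDyer.Theorems.AdditiveKoly

end
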